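import Summits.ValiantsHypothesis.ValiantsHypothesis.Theorems.MonotoneRestorationOrbitRestorationQPValueOrbitConverse
import Summits.ValiantsHypothesis.ValiantsHypothesis.Theorems.MonotoneRestorationOrbitRestorationQPValueOrbitRestoration
import HarnessLib

/-!
# `OrbitRestorationQP` ⟺ its value-orbit form (symmetrisation in ORBIT currency, VI)

Route MonotoneRestoration, crux `OrbitRestorationQP` (stmt-ValiantsHypothesis-18293), namespace
`Summit.ValiantsHypothesis.ValiantsHypothesis.Theorems.SymmetricValues`.

* `ncard_range_le_orbitSize` — a gate function transported by automorphisms (`Φ (π g) = γ • Φ g`) has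
  value orbits no larger than Dawar–Wilsenach gate orbits; instances: gate values, their powers, the power
  sums / elementary symmetric values / Newton products of the children values (`map_esymm_ringHom`);
* `toDerivation`, `exists_valueDerivation_of_symmetric` — **CONVERSE of the value-orbit symmetrisation
  theorem**: a `Γ`-symmetric circuit `C` computing `f` yields a value derivation of `f` (weighted sums,
  BINARY products — unbounded products binarised by Newton's identities, `…ValueOrbitConverse.lean`) all of
  whose values have `Γ`-orbits `≤ ORB(C)`;
* `orbitRestorationQP_iff_valueOrbitQP` — **THE CRUX IS EQUIVALENT TO ITS VALUE-ORBIT FORM**: every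
  matrix-symmetric `VP` family over `ℂ` has, at every `n`, SOME ordinary computation (any length) all of
  whose intermediate values have `Sym(Fin n)`-orbits (diagonal action) `≤ 2^((log₂ n + c)^c)`.  Symmetric
  circuits are eliminated from the statement of the crux; what remains is a question about the orbits of
  intermediate values of ordinary `VP` computations.

Everything is proved; the crux itself (VH-strength) is not claimed. [folklore]

## References
* A. Dawar, G. Wilsenach, *Symmetric arithmetic circuits*, ToC 21 (2025), §3.3. [DawarWilsenach2025]
-/

noncomputable section

open scoped Classical

-- `Summit.ValiantsHypothesis.ValiantsHypothesis.…` is the tree's single-conjunct layout (Sub = Summit).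
set_option linter.dupNamespace false

namespace Summit.ValiantsHypothesis.ValiantsHypothesis.Theorems

universe u v w

namespace SymmetricValues

open Literature.Computability.AlgebraicComplexity LabelledArithCircuit Finset

variable {K : Type u} {X : Type v} {G : Type w} [Field K] (C : LabelledArithCircuit K X Unit G)
variable {Γ : Type*} [Group Γ] [MulAction Γ X]

/-! ### Value orbits inside gate orbits -/

/-- **A gate function transported by automorphisms has value orbits inside gate orbits**: if
`γ • Φ g = Φ (π g)` for every automorphism `π` over `γ`, then `|Γ • Φ g| ≤ ORB(C)` for a `Γ`-symmetric
`C`. [folklore] -/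
theorem ncard_range_le_orbitSize [Fintype G] (hC : C.IsSymmetric Γ) (Φ : G → MvPolynomial X K)
    (hΦ : ∀ (γ : Γ) (π : Equiv.Perm G), C.IsAutomorphismExtending γ π → ∀ g, ren γ (Φ g) = Φ (π g))
    (g : G) : (Set.range fun γ : Γ => ren γ (Φ g)).ncard ≤ C.orbitSize Γ := by
  have hsub : (Set.range fun γ : Γ => ren γ (Φ g)) ⊆ Φ '' C.autOrbit Γ g := by
    rintro _ ⟨γ, rfl⟩
    obtain ⟨π, hπ⟩ := hC γ
    exact ⟨π g, ⟨γ, π, hπ, rfl⟩, (hΦ γ π hπ g).symm⟩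
  exact (Set.ncard_le_ncard hsub ((Set.toFinite _).image Φ)).trans
    ((Set.ncard_image_le (Set.toFinite _)).trans (C.ncard_autOrbit_le_orbitSize Γ g))

omit [Field K] in
/-- Ring homomorphisms pass through elementary symmetric functions of multisets. [folklore] -/
theorem map_esymm_ringHom {R S : Type*} [CommSemiring R] [CommSemiring S] (f : R →+* S)
    (s : Multiset R) (k : ℕ) : f (s.esymm k) = (s.map f).esymm k := by
  simp only [Multiset.esymm, map_multiset_sum, Multiset.map_map, Function.comp_def, map_multiset_prod,
    Multiset.powersetCard_map]

variable {C}

/-- Gate values transport. [folklore] -/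
theorem ren_eval {γ : Γ} {π : Equiv.Perm G} (hπ : C.IsAutomorphismExtending γ π) (g : G) :
    ren γ (C.eval g) = C.eval (π g) :=
  (hπ.eval_apply g).symm

/-- Power sums of children values transport. [folklore] -/
theorem ren_chP {γ : Γ} {π : Equiv.Perm G} (hπ : C.IsAutomorphismExtending γ π) (g : G) (j : ℕ) :
    ren γ (chP C g j) = chP C (π g) j := by
  simp only [chP, map_sum, map_pow, ren_eval hπ, hπ.children_apply g, Finset.sum_map]
  rfl

/-- Elementary symmetric values of children transport. [folklore] -/
theorem ren_chE {γ : Γ} {π : Equiv.Perm G} (hπ : C.IsAutomorphismExtending γ π) (g : G) (k : ℕ) :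
    ren γ (chE C g k) = chE C (π g) k := by
  rw [chE, chE, show (ren γ) (((C.children g).val.map C.eval).esymm k) =
    (ren (K := K) γ).toRingHom (((C.children g).val.map C.eval).esymm k) from rfl, map_esymm_ringHom,
    hπ.children_apply g, Finset.map_val, Multiset.map_map, Multiset.map_map]
  congr 2
  funext h
  exact ren_eval hπ h

/-! ### The derivation of a symmetric circuit -/

variable (C) [Fintype G]

/-- The rank of a value: the least rank of a name with that value. [folklore] -/
def vrank (q : MvPolynomial X K) : ℕ := sInf {r : ℕ | ∃ ν ∈ names C, nval C ν = q ∧ nrank C ν = r}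

/-- **The value derivation of a circuit**: the values of all names (gate values, powers, power sums,
Newton products, elementary symmetric values), each derived by the step of a least-rank name.
[folklore] -/
def toDerivation [CharZero K] : ValueDerivation K X where
  S := (names C).image (nval C)
  rank := vrank C
  step := by
    intro q hq
    obtain ⟨ν, hν, hq'⟩ := mem_image.1 hq
    have hne : {r : ℕ | ∃ ν ∈ names C, nval C ν = q ∧ nrank C ν = r}.Nonempty := ⟨_, ν, hν, hq', rfl⟩
    obtain ⟨μ, hμ, hμq, hμr⟩ := Nat.sInf_mem hne
    refine ⟨recipe C μ, ⟨?_, ?_⟩⟩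
    · rw [recipe_value C μ hμ, hμq]
    · intro u hu
      obtain ⟨κ, hκ, hκu, hlt⟩ := recipe_args C μ hμ hu
      refine ⟨mem_image.2 ⟨κ, hκ, hκu⟩, ?_⟩
      calc vrank C u ≤ nrank C κ := Nat.sInf_le ⟨κ, hκ, hκu, rfl⟩
        _ < nrank C μ := hlt
        _ = vrank C q := hμr

/-- **CONVERSE OF THE VALUE-ORBIT SYMMETRISATION THEOREM.**  A `Γ`-symmetric circuit computing `f`
(characteristic `0`) yields a value derivation of `f` — weighted sums of any fan-in and BINARY products,
the circuit's unbounded products being binarised by Newton's identities — all of whose values have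
`Γ`-orbits of size at most the orbit size `ORB(C)`. [folklore] -/
theorem exists_valueDerivation_of_symmetric [CharZero K] (hC : C.IsSymmetric Γ) :
    ∃ 𝒟 : ValueDerivation K X, C.eval (C.output ()) ∈ 𝒟.S ∧
      ∀ q ∈ 𝒟.S, (Set.range fun γ : Γ => ren γ q).ncard ≤ C.orbitSize Γ := by
  refine ⟨toDerivation C, mem_image.2 ⟨Nm.gate _, gate_mem_names C _, rfl⟩, fun q hq => ?_⟩
  obtain ⟨ν, -, rfl⟩ := mem_image.1 hq
  cases ν with
  | gate g => exact ncard_range_le_orbitSize C hC (fun g => C.eval g) (fun γ π hπ g => ren_eval hπ g) g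
  | pw h j =>
    exact ncard_range_le_orbitSize C hC (fun h => C.eval h ^ j)
      (fun γ π hπ h => by simp only [map_pow, ren_eval hπ h]) h
  | ps g j => exact ncard_range_le_orbitSize C hC (fun g => chP C g j) (fun γ π hπ g => ren_chP hπ g j) g
  | nt g a =>
    exact ncard_range_le_orbitSize C hC (fun g => chE C g a.1 * chP C g a.2)
      (fun γ π hπ g => by simp only [map_mul, ren_chE hπ, ren_chP hπ]) g
  | es g k => exact ncard_range_le_orbitSize C hC (fun g => chE C g k) (fun γ π hπ g => ren_chE hπ g k) g

end SymmetricValues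

/-! ### The equivalence -/

namespace ValueOrbit

open Literature.Computability.AlgebraicComplexity

/-- **`OrbitRestorationQP` IS EQUIVALENT TO ITS VALUE-ORBIT FORM.**  The crux — every matrix-symmetric
`VP` family over `ℂ` has square-symmetric circuits of quasi-polynomial ORBIT size — holds if and only if
every matrix-symmetric `VP` family has, for one constant `c` and every `n`, SOME value derivation of `f n`
(an ordinary straight-line computation of any length: weighted sums of any fan-in, binary products) all
of whose intermediate VALUES have `Sym(Fin n)`-orbits (diagonal action) of size `≤ 2^((log₂ n + c)^c)`.
(`⇐`: value-orbit symmetrisation, `orbitRestorationQP_of_valueOrbitQP`; `⇒`: the values of the gates of a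
symmetric circuit, products binarised by Newton's identities,
`SymmetricValues.exists_valueDerivation_of_symmetric`.)  Neither side is claimed. [folklore] -/
theorem orbitRestorationQP_iff_valueOrbitQP :
    Theses.MonotoneRestoration.OrbitRestorationQP ↔
    ∀ f : (n : ℕ) → MvPolynomial (Fin n × Fin n) ℂ,
      (∀ (n : ℕ) (σ τ : Equiv.Perm (Fin n)),
        MvPolynomial.rename (fun p : Fin n × Fin n => (σ p.1, τ p.2)) (f n) = f n) →
      IsVPFamily f →
      ∃ c : ℕ, ∀ n : ℕ, ∃ 𝒟 : ValueDerivation ℂ (Fin n × Fin n), f n ∈ 𝒟.S ∧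
        ∀ q ∈ 𝒟.S, (Set.range fun σ : Equiv.Perm (Fin n) => ren σ q).ncard ≤ 2 ^ ((Nat.log 2 n + c) ^ c) := by
  refine ⟨fun h f hsymm hVP => ?_, orbitRestorationQP_of_valueOrbitQP⟩
  obtain ⟨c, hc⟩ := h f hsymm hVP
  refine ⟨c, fun n => ?_⟩
  obtain ⟨G, inst, C, hC, hev, horb⟩ := hc n
  obtain ⟨𝒟, hf, hS⟩ := SymmetricValues.exists_valueDerivation_of_symmetric C hC
  exact ⟨𝒟, hev ▸ hf, fun q hq => (hS q hq).trans horb⟩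

end ValueOrbit

end Summit.ValiantsHypothesis.ValiantsHypothesis.Theorems

end
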